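import Summits.AtomisticToContinuum.Crystallization.Theorems.FrustratedLawDichotomyLensFive

/-!
# FrustratedLawDichotomy · crux `AperiodicFrustratedLawGap` (stmt-AtomisticToContinuum-27623) — THE THREE-POINT LENS LEMMA: two points at
# distance `≥ D₀` (close to `√3`) have at most TWO common near-unit neighbours that are pairwise separated (decomp-a2c, prover hand 2, gen 10)

Companion of `FrustratedLawDichotomyLensFive` (p823384).  There the count was five (for `CapMatchCert`: a square diagonal `≈ √2` with five
common neighbours); here it is three, for the «no twist» step of P: a TWISTED corner correspondence makes a `√3`-pair `p a, p c` of the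
centre's link (one common contact `w` in the pattern) acquire a THIRD common neighbour — the second common contact, in the neighbour's link,
of the diagonal pair that `a, c` are twisted onto — besides the centre `0` and the corner `p w`.  Three points of a disc of radius `R`
pairwise `≥ s'` apart need `s' ≤ √3·R` (two of three directions are within `2π/3`; the inscribed equilateral triangle is extremal):

* ★ `lens_three_false` : `A, B` with `dist A B ≥ D₀ > 0`; three points with `lo ≤ dist² ≤ hi` to both, pairwise `≥ s ≥ 0`; and
  `3 · (hi − D₀²/4) < s² − ((hi − lo)/D₀)²`.  Then `False`.  (At `θ = 1/100`, windows `[(1+θ)⁻², (1+θ)⁴]`, `s = (1+θ)⁻¹`: any `D₀ ≥ 1.695`.)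
* pieces: `three_sorted_angles_exists_cos_ge` (three sorted directions have two within `2π/3`), `planar_bound_three`.
`[folklore]`; def-free; no `sorry`.
-/

noncomputable section

namespace Summit.AtomisticToContinuum.Crystallization.Theorems.FrustratedLawDichotomyLensThree

open Real RealInnerProductSpace
open Summit.AtomisticToContinuum.Crystallization.Theorems.FrustratedLawDichotomyLensFive
  (planar_dist_sq exists_frame dist_sq_decomp dist_sq_eq_sum_sq)

/-- **Three sorted directions on a circle have two within `2π/3`**: for `−π < t₀ < t₁ < t₂ ≤ π` some pair `i ≠ j` has
`cos (tᵢ − tⱼ) ≥ cos (2π/3) = −1/2`. [folklore] -/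
theorem three_sorted_angles_exists_cos_ge (t : Fin 3 → ℝ) (hmono : StrictMono t) (hlo : -π < t 0) (hhi : t 2 ≤ π) :
    ∃ i j : Fin 3, i ≠ j ∧ -(1 / 2 : ℝ) ≤ cos (t i - t j) := by
  have h01 : t 0 < t 1 := hmono (by decide)
  have h12 : t 1 < t 2 := hmono (by decide)
  have hπ3 : 2 * π / 3 ≤ π := by linarith [pi_pos]
  have hc : cos (2 * π / 3) = -(1 / 2 : ℝ) := by
    rw [show 2 * π / 3 = π - π / 3 by ring, cos_pi_sub, cos_pi_div_three]
  rw [← hc]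
  by_cases g1 : t 1 - t 0 ≤ 2 * π / 3
  · exact ⟨1, 0, by decide, cos_le_cos_of_nonneg_of_le_pi (by linarith) hπ3 g1⟩
  by_cases g2 : t 2 - t 1 ≤ 2 * π / 3
  · exact ⟨2, 1, by decide, cos_le_cos_of_nonneg_of_le_pi (by linarith) hπ3 g2⟩
  push Not at g1 g2
  have g3 : 2 * π - (t 2 - t 0) ≤ 2 * π / 3 := by linarith
  refine ⟨2, 0, by decide, ?_⟩
  rw [← cos_two_pi_sub (t 2 - t 0)]
  exact cos_le_cos_of_nonneg_of_le_pi (by linarith) hπ3 g3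

/-- **Two points of the disc of radius `R` within angle `2π/3` are at squared distance `≤ 3R²`**: for `0 ≤ ρ, ρ' ≤ R` and `c ≥ −1/2`,
`ρ² + ρ'² − 2ρρ'c ≤ 3R²`. [folklore] -/
theorem planar_bound_three {ρ ρ' R c : ℝ} (hρ0 : 0 ≤ ρ) (hρR : ρ ≤ R) (hρ'0 : 0 ≤ ρ') (hρ'R : ρ' ≤ R) (hc : -(1 / 2 : ℝ) ≤ c) :
    ρ ^ 2 + ρ' ^ 2 - 2 * (ρ * ρ') * c ≤ 3 * R ^ 2 := by
  have h1 : ρ * ρ' * (-(1 / 2 : ℝ)) ≤ ρ * ρ' * c := mul_le_mul_of_nonneg_left hc (mul_nonneg hρ0 hρ'0)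
  have h3 : ρ * ρ' ≤ R ^ 2 := by nlinarith [mul_le_mul hρR hρ'R hρ'0 (hρ0.trans hρR)]
  nlinarith [pow_le_pow_left₀ hρ0 hρR 2, pow_le_pow_left₀ hρ'0 hρ'R 2]

/-- ★ **THE THREE-POINT LENS LEMMA.**  Two points `A, B` at distance `≥ D₀ > 0` do not have three common neighbours `P₀, P₁, P₂` in the
squared-distance window `[lo, hi]` that are pairwise `≥ s` apart, provided `3 · (hi − D₀²/4) < s² − ((hi − lo)/D₀)²`. [folklore] -/
theorem lens_three_false {A B : EuclideanSpace ℝ (Fin 3)} {P : Fin 3 → EuclideanSpace ℝ (Fin 3)} {D₀ lo hi s : ℝ}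
    (hD₀ : 0 < D₀) (hd : D₀ ≤ dist A B)
    (hA : ∀ k, lo ≤ dist (P k) A ^ 2 ∧ dist (P k) A ^ 2 ≤ hi) (hB : ∀ k, lo ≤ dist (P k) B ^ 2 ∧ dist (P k) B ^ 2 ≤ hi)
    (hs : 0 ≤ s) (hsep : ∀ i j, i ≠ j → s ≤ dist (P i) (P j))
    (hnum : 3 * (hi - D₀ ^ 2 / 4) < s ^ 2 - ((hi - lo) / D₀) ^ 2) : False := by
  set d := dist A B with hd_def
  have hdpos : 0 < d := hD₀.trans_le hd
  have hAB : A ≠ B := fun h => by rw [hd_def, h, dist_self] at hdpos; exact lt_irrefl _ hdpos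
  obtain ⟨b, hBA⟩ := exists_frame hAB
  rw [← hd_def] at hBA
  set M : EuclideanSpace ℝ (Fin 3) := (1 / 2 : ℝ) • (A + B) with hM
  set X : Fin 3 → ℝ := fun k => ⟪b 0, P k - M⟫ with hXdef
  set Y : Fin 3 → ℝ := fun k => ⟪b 1, P k - M⟫ with hYdef
  set H : Fin 3 → ℝ := fun k => ⟪b 2, P k - M⟫ with hHdef
  have key : ∀ k, dist (P k) A ^ 2 = X k ^ 2 + Y k ^ 2 + H k ^ 2 + d * H k + d ^ 2 / 4 ∧
      dist (P k) B ^ 2 = X k ^ 2 + Y k ^ 2 + H k ^ 2 - d * H k + d ^ 2 / 4 := fun k => dist_sq_decomp b hBA (P k)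
  have hlohi : lo ≤ hi := (hA 0).1.trans (hA 0).2
  set δ : ℝ := (hi - lo) / (2 * D₀) with hδ
  have hH : ∀ k, |H k| ≤ δ := by
    intro k
    obtain ⟨hk1, hk2⟩ := key k
    have hdH : |d * H k| ≤ (hi - lo) / 2 := by
      rw [abs_le]; constructor <;> nlinarith [(hA k).1, (hA k).2, (hB k).1, (hB k).2]
    rw [abs_mul, abs_of_pos hdpos] at hdH
    rw [hδ, le_div_iff₀ (by positivity)]
    calc |H k| * (2 * D₀) ≤ |H k| * (2 * d) := by gcongr
      _ = 2 * (d * |H k|) := by ring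
      _ ≤ 2 * ((hi - lo) / 2) := by gcongr
      _ = hi - lo := by ring
  set R2 : ℝ := hi - D₀ ^ 2 / 4 with hR2
  have hρ2 : ∀ k, X k ^ 2 + Y k ^ 2 ≤ R2 := by
    intro k
    obtain ⟨hk1, hk2⟩ := key k
    have hdd : D₀ ^ 2 ≤ d ^ 2 := pow_le_pow_left₀ hD₀.le hd 2
    nlinarith [(hA k).2, (hB k).2, sq_nonneg (H k)]
  have hR2nn : 0 ≤ R2 := by nlinarith [hρ2 0, sq_nonneg (X 0), sq_nonneg (Y 0)]
  set R : ℝ := Real.sqrt R2 with hR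
  have hRsq : R ^ 2 = R2 := Real.sq_sqrt hR2nn
  set S2 : ℝ := s ^ 2 - ((hi - lo) / D₀) ^ 2 with hS2
  have hplanar : ∀ i j, i ≠ j → S2 ≤ (X i - X j) ^ 2 + (Y i - Y j) ^ 2 := by
    intro i j hij
    have h1 : dist (P i) (P j) ^ 2 = (X i - X j) ^ 2 + (Y i - Y j) ^ 2 + (H i - H j) ^ 2 := dist_sq_eq_sum_sq b M (P i) (P j)
    have h2 : s ^ 2 ≤ dist (P i) (P j) ^ 2 := pow_le_pow_left₀ hs (hsep i j hij) 2
    have h3 : (H i - H j) ^ 2 ≤ ((hi - lo) / D₀) ^ 2 := by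
      have hi' := hH i
      have hj' := hH j
      rw [abs_le] at hi' hj'
      have h2δ : 2 * δ = (hi - lo) / D₀ := by rw [hδ]; field_simp
      rw [← h2δ]
      nlinarith [hi'.1, hi'.2, hj'.1, hj'.2]
    rw [hS2]; linarith
  set θ : Fin 3 → ℝ := fun k => Complex.arg ⟨X k, Y k⟩ with hθdef
  set ρ : Fin 3 → ℝ := fun k => ‖(⟨X k, Y k⟩ : ℂ)‖ with hρdef
  have hρnn : ∀ k, 0 ≤ ρ k := fun k => norm_nonneg _
  have hρsq : ∀ k, ρ k ^ 2 = X k ^ 2 + Y k ^ 2 := by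
    intro k
    simp only [hρdef]
    rw [Complex.norm_def, Real.sq_sqrt (Complex.normSq_nonneg _), Complex.normSq_mk]; ring
  have hρR : ∀ k, ρ k ≤ R := by
    intro k
    rw [hR, ← Real.sqrt_sq (hρnn k)]
    exact Real.sqrt_le_sqrt (by rw [hρsq]; exact hρ2 k)
  have hpl : ∀ i j, (X i - X j) ^ 2 + (Y i - Y j) ^ 2 = ρ i ^ 2 + ρ j ^ 2 - 2 * (ρ i * ρ j) * cos (θ i - θ j) :=
    fun i j => planar_dist_sq (X i) (Y i) (X j) (Y j)
  have pair_false : ∀ i j, i ≠ j → -(1 / 2 : ℝ) ≤ cos (θ i - θ j) → False := by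
    intro i j hij hcos
    have h1 := hplanar i j hij
    have h2 := planar_bound_three (hρnn i) (hρR i) (hρnn j) (hρR j) hcos
    rw [hpl i j] at h1
    rw [hRsq] at h2
    linarith
  by_cases hinj : Function.Injective θ
  · have hAcard : (Finset.univ.image θ).card = 3 := by
      rw [Finset.card_image_of_injective _ hinj, Finset.card_univ, Fintype.card_fin]
    let e := (Finset.univ.image θ).orderEmbOfFin hAcard
    have hmem : ∀ k, ∃ i, θ i = e k := by
      intro k
      have := (Finset.univ.image θ).orderEmbOfFin_mem hAcard k
      rw [Finset.mem_image] at this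
      obtain ⟨i, -, hi⟩ := this
      exact ⟨i, hi⟩
    choose π' hπ' using hmem
    obtain ⟨i, j, hij, hcos⟩ := three_sorted_angles_exists_cos_ge (fun k => e k) e.strictMono
      (by show -π < e 0; rw [← hπ' 0]; exact Complex.neg_pi_lt_arg _)
      (by show e 2 ≤ π; rw [← hπ' 2]; exact Complex.arg_le_pi _)
    have hne : π' i ≠ π' j := by
      intro h
      apply hij
      apply e.injective
      rw [← hπ' i, ← hπ' j, h]
    refine pair_false (π' i) (π' j) hne ?_
    rw [hπ' i, hπ' j]
    exact hcos
  · obtain ⟨i, j, hθij, hij⟩ := Function.not_injective_iff.1 hinj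
    refine pair_false i j hij ?_
    rw [hθij, sub_self, cos_zero]
    norm_num

end Summit.AtomisticToContinuum.Crystallization.Theorems.FrustratedLawDichotomyLensThree

end
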